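import Literature.NumberTheory.GaloisRepresentations.LocalFieldFiniteExtension
import Literature.NumberTheory.GaloisRepresentations.DeformationCofinalSubgroups
import Mathlib.Analysis.Normed.Field.Krasner
import Mathlib.Analysis.Normed.Field.Approximation
import Mathlib.Analysis.Normed.Module.FiniteDimension
import Mathlib.SetTheory.Cardinal.Subfield
import Mathlib.Algebra.Polynomial.Cardinal
import Mathlib.FieldTheory.PrimitiveElement
import HarnessLib

/-!
# A `p`-adic field has countably many finite extensions inside `F̄`; cofinal sequences of open
# normal subgroups of `Γ_F`

Let `F` be a non-archimedean local field of characteristic `0` and `F̄ = AlgebraicClosure F`.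
We PROVE:

* `countable_setOf_finiteDimensional_intermediateField` — the finite subextensions `E ⊆ F̄` of `F`
  form a COUNTABLE set.  Proof (Krasner): `F` is locally compact, hence separable; let `K₀ ⊆ F`
  be a countable dense subfield.  A finite `E/F` is `F(α)` (primitive element), `f = minpoly α`;
  approximating the coefficients of `f` by elements of `K₀` gives a monic `g ∈ K₀[X]` of the same
  degree with a root `β ∈ F̄` closer to `α` than every other conjugate of `α` (continuity of roots,
  Mathlib `Polynomial.exists_aroots_norm_sub_lt_of_norm_coeff_sub_lt`), so `α ∈ F(β)` by
  **Krasner's lemma** (Mathlib `IsKrasner.of_completeSpace`, for the spectral norm of `F̄`) and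
  `F(α) = F(β)` by degrees.  Hence every finite `E` is `F(β)` for a root `β` of a polynomial with
  coefficients in the countable field `K₀`.  (Krasner: Cassels, *Local Fields*, Ch. 7 §3, Cor. 2–3;
  this is the argument behind "a `p`-adic field has only finitely many extensions of given degree",
  Lang, *Algebraic Number Theory*, II §5 Prop. 14 — we only need and prove countability.)
* `countable_openSubgroup_of_isNonarchimedeanLocalField` — consequently `Γ_F` has
  countably many open subgroups (an open subgroup contains `Gal(F̄/E)` for a finite `E`, above
  which there are finitely many subgroups), and
* `exists_antitone_openNormal_seq_le_of_isNonarchimedeanLocalField` — `Γ_F`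
  has a cofinal decreasing sequence of open normal subgroups inside any given open subgroup (the tree's
  `Deformation.exists_antitone_openNormal_seq`), the input of the sequential construction of
  universal deformation rings (`Deformation.LiftingCondition.exists_universal_of_finite`,
  Mazur §20 Prop. 2) for representations of `Γ_F`.

Everything is proved; no named facts.

## References

* J. W. S. Cassels, *Local Fields* (CUP 1986), Ch. 7 §3, Cor. 2 (conjugates have the same
  absolute value) and Cor. 3 (Krasner). [cite: Cassels1986, Ch. 7 §3 Cor. 3]
* S. Lang, *Algebraic Number Theory*, 2nd ed. (Springer GTM 110, 1994), Ch. II §5, Prop. 14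
  (finiteness of the extensions of bounded degree of a `p`-adic field, via Krasner's lemma).
* J. Neukirch, *Algebraic Number Theory* (1999), Ch. IV §1 (Krull topology).
  [cite: NeukirchANT1999, Ch. IV §1]
* B. Mazur, *An introduction to the deformation theory of Galois representations* (1997), §20.
  [cite: Mazur1997Deformation, §20 Prop. 2]
-/

noncomputable section

open Field Topology Filter Polynomial IntermediateField

universe u

namespace Literature.NumberTheory.GaloisRepresentations

/-! ### Subgroups above an open subgroup of a compact group -/

section General

variable {G : Type*} [Group G] [TopologicalSpace G] [IsTopologicalGroup G] [CompactSpace G]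

/-- In a compact group the subgroups containing a given OPEN subgroup are finite in number
(they correspond to subsets of the finite coset space). [folklore] -/
theorem finite_setOf_subgroup_le_of_isOpen (H : Subgroup G) (hH : IsOpen (H : Set G)) :
    {V : Subgroup G | H ≤ V}.Finite := by
  haveI : Finite (G ⧸ H) := Subgroup.quotient_finite_of_isOpen H hH
  refine Set.Finite.of_finite_image (f := fun V : Subgroup G =>
    ((QuotientGroup.mk : G → G ⧸ H) '' (V : Set G))) (Set.toFinite _) ?_
  intro V₁ hV₁ V₂ hV₂ h
  simp only at h
  have key : ∀ {W₁ W₂ : Subgroup G}, H ≤ W₂ →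
      (QuotientGroup.mk '' (W₁ : Set G) : Set (G ⧸ H)) = QuotientGroup.mk '' (W₂ : Set G) →
        W₁ ≤ W₂ := by
    intro W₁ W₂ hW₂ himg x hx
    have : (QuotientGroup.mk x : G ⧸ H) ∈ QuotientGroup.mk '' (W₂ : Set G) := himg ▸ ⟨x, hx, rfl⟩
    obtain ⟨y, hy, hyx⟩ := this
    have hxy : x⁻¹ * y ∈ H := QuotientGroup.eq.1 hyx.symm
    have : x = y * (x⁻¹ * y)⁻¹ := by group
    rw [this]
    exact W₂.mul_mem hy (W₂.inv_mem (hW₂ hxy))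
  exact le_antisymm (key hV₂ h) (key hV₁ h.symm)

end General

/-! ### A countable dense subfield -/

section LocalField

variable (F : Type u) [Field F] [ValuativeRel F] [TopologicalSpace F] [IsNonarchimedeanLocalField F]

/-- **A non-archimedean local field has a countable dense subfield**: it is locally compact,
hence a proper, second countable, separable metric space for its absolute value; take the
subfield generated by a countable dense subset. [folklore] -/
theorem exists_countable_dense_subfield :
    ∃ K₀ : Subfield F, (K₀ : Set F).Countable ∧ Dense (K₀ : Set F) := by
  letI := IsNonarchimedeanLocalField.nontriviallyNormedField F
  haveI : ProperSpace F := ProperSpace.of_locallyCompactSpace F (E := F)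
  obtain ⟨D, hDc, hDd⟩ := TopologicalSpace.exists_countable_dense F
  refine ⟨Subfield.closure D, ?_, hDd.mono Subfield.subset_closure⟩
  rw [← Cardinal.le_aleph0_iff_set_countable]
  exact (Subfield.cardinalMk_closure_le_max D).trans
    (max_le (Cardinal.le_aleph0_iff_set_countable.mpr hDc) le_rfl)

variable [CharZero F]

/-- **The finite subextensions of `F̄/F` form a countable set**, for `F` a non-archimedean local
field of characteristic `0` (Krasner's lemma + continuity of roots + separability of `F`; see the
module docstring).  Cf. Lang, *Algebraic Number Theory*, II §5 Prop. 14 (finitely many extensions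
of each degree). [cite: Cassels1986, Ch. 7 §3 Cor. 3] -/
theorem countable_setOf_finiteDimensional_intermediateField :
    {E : IntermediateField F (AlgebraicClosure F) | FiniteDimensional F E}.Countable := by
  classical
  obtain ⟨K₀, hK₀c, hK₀d⟩ := exists_countable_dense_subfield F
  -- the absolute values of `F` and `F̄`
  letI := IsNonarchimedeanLocalField.nontriviallyNormedField F
  haveI : CompleteSpace F := IsNonarchimedeanLocalField.completeSpace_nontriviallyNormedField F
  haveI : IsUltrametricDist F :=
    IsNonarchimedeanLocalField.isUltrametricDist_nontriviallyNormedField F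
  letI : NormedField (AlgebraicClosure F) := spectralNorm.normedField F (AlgebraicClosure F)
  letI : NormedAlgebra F (AlgebraicClosure F) := spectralNorm.normedAlgebra F (AlgebraicClosure F)
  -- the countable set of roots of polynomials with coefficients in `K₀`
  haveI : Countable K₀ := hK₀c.to_subtype
  haveI : Countable K₀[X] := by
    rw [← Cardinal.mk_le_aleph0_iff]
    exact Polynomial.cardinalMk_le_max.trans (max_le Cardinal.mk_le_aleph0 le_rfl)
  let B : Set (AlgebraicClosure F) :=
    ⋃ g₀ : K₀[X], (g₀.map (algebraMap K₀ F)).rootSet (AlgebraicClosure F)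
  have hB : B.Countable := Set.countable_iUnion fun g₀ => (Polynomial.rootSet_finite _ _).countable
  refine (hB.image fun β => F⟮β⟯).mono ?_
  rintro E (hE : FiniteDimensional F E)
  -- a primitive element `α` of `E`, its minimal polynomial `f` of degree `n ≥ 1`
  obtain ⟨α₀, hα₀⟩ := Field.exists_primitive_element F E
  have hEα : E = F⟮(α₀ : AlgebraicClosure F)⟯ := by
    rw [← lift_adjoin_simple (K := E) (α := α₀), hα₀, IntermediateField.lift_top]
  set α : AlgebraicClosure F := (α₀ : AlgebraicClosure F) with hαdef
  have hαint : IsIntegral F α := Algebra.IsIntegral.isIntegral α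
  set f : F[X] := minpoly F α with hf
  have hfm : f.Monic := minpoly.monic hαint
  have hn : f.natDegree ≠ 0 := (minpoly.natDegree_pos hαint).ne'
  -- the bound of the continuity of roots tends to `0` with `ε`
  set M : ℝ := max ‖α‖ 1 with hM
  let bnd : ℝ → ℝ := fun ε => ((f.natDegree + 1) * ε) ^ (f.natDegree : ℝ)⁻¹ * M
  have hbnd : Tendsto bnd (𝓝 0) (𝓝 0) := by
    have h1 : Continuous bnd :=
      ((continuous_const.mul continuous_id).rpow_const fun _ => Or.inr (by positivity)).mul
        continuous_const
    have h0 : bnd 0 = 0 := by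
      simp only [bnd, mul_zero]
      rw [Real.zero_rpow (inv_ne_zero (Nat.cast_ne_zero.mpr hn)), zero_mul]
    simpa [h0] using h1.tendsto 0
  have hev : ∀ᶠ ε in 𝓝 (0 : ℝ), ∀ α' ∈ f.rootSet (AlgebraicClosure F), α' ≠ α → bnd ε < ‖α - α'‖ := by
    rw [(f.rootSet_finite (AlgebraicClosure F)).eventually_all]
    intro α' _
    by_cases h : α' = α
    · exact Eventually.of_forall fun _ h' => (h' h).elim
    · have hpos : (0 : ℝ) < ‖α - α'‖ := norm_pos_iff.mpr (sub_ne_zero.mpr (Ne.symm h))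
      exact (hbnd.eventually_lt_const hpos).mono fun _ h' _ => h'
  obtain ⟨ε, hε, hεpos⟩ := ((hev.filter_mono nhdsWithin_le_nhds).and
    (self_mem_nhdsWithin (s := Set.Ioi (0 : ℝ)) (a := 0))).exists
  replace hεpos : (0 : ℝ) < ε := hεpos
  -- a monic `g ∈ K₀[X]` of the same degree with coefficients `ε`-close to those of `f`
  have hd : DenseRange (algebraMap K₀ F) := by
    have hr : Set.range (algebraMap K₀ F) = (K₀ : Set F) := Subtype.range_val
    rw [DenseRange, hr]
    exact hK₀d
  obtain ⟨g₀, hg₀m, hdeg, hcoeff⟩ :=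
    Polynomial.exists_monic_and_natDegree_eq_and_norm_map_algebraMap_coeff_sub_lt hd hfm hεpos
  set g : F[X] := g₀.map (algebraMap K₀ F) with hg
  have hgm : g.Monic := hg₀m.map _
  have hgdeg : g.natDegree = f.natDegree := by rw [hg, natDegree_map, ← hdeg]
  -- continuity of roots: a root `β` of `g` close to `α`
  obtain ⟨β, hβ, hαβ⟩ := Polynomial.exists_aroots_norm_sub_lt_of_norm_coeff_sub_lt hεpos
    (minpoly.aeval F α) hfm hgm hgdeg hcoeff (IsAlgClosed.splits _)
  have hgβ : g ≠ 0 ∧ aeval β g = 0 := mem_aroots.mp hβ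
  -- Krasner: `α ∈ F(β)`
  have hβint : IsIntegral F β := Algebra.IsIntegral.isIntegral β
  have hαmem : α ∈ F⟮β⟯ := by
    refine IsKrasner.krasner (K := F) (Algebra.IsSeparable.isSeparable F α) (IsAlgClosed.splits _)
      hβint fun α' hconj hne => ?_
    have hmem : α' ∈ f.rootSet (AlgebraicClosure F) :=
      (isConjRoot_iff_mem_minpoly_rootSet hαint).mp hconj
    exact hαβ.trans (hε α' hmem (Ne.symm hne))
  -- degrees: `F(α) = F(β)`
  have hle : F⟮α⟯ ≤ F⟮β⟯ := adjoin_simple_le_iff.mpr hαmem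
  haveI : FiniteDimensional F F⟮β⟯ := adjoin.finiteDimensional hβint
  have hfin : Module.finrank F F⟮β⟯ ≤ Module.finrank F F⟮α⟯ := by
    rw [adjoin.finrank hβint, adjoin.finrank hαint]
    calc (minpoly F β).natDegree ≤ g.natDegree :=
          natDegree_le_of_dvd (minpoly.dvd F β hgβ.2) hgm.ne_zero
      _ = f.natDegree := hgdeg
  have heq : F⟮α⟯ = F⟮β⟯ := eq_of_le_of_finrank_le hle hfin
  refine ⟨β, Set.mem_iUnion.mpr ⟨g₀, ?_⟩, ?_⟩
  · exact mem_rootSet.mpr hgβ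
  · change F⟮β⟯ = E
    rw [hEα]
    exact heq.symm

/-- **`Γ_F` has countably many open subgroups** for a non-archimedean local field `F` of
characteristic `0`: an open subgroup contains `Gal(F̄/E)` for some finite subextension `E` (Krull
topology), there are countably many such `E`
(`countable_setOf_finiteDimensional_intermediateField`), and finitely many subgroups above each
open `Gal(F̄/E)`.  Stated as the countability of the TYPE of open subgroups of `Γ_F`.
[cite: NeukirchANT1999, Ch. IV §1] -/
theorem countable_openSubgroup_of_isNonarchimedeanLocalField :
    Countable (OpenSubgroup (absoluteGaloisGroup F)) := by
  have hc := countable_setOf_finiteDimensional_intermediateField F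
  let HS : IntermediateField F (AlgebraicClosure F) → Subgroup (absoluteGaloisGroup F) := fun E =>
    E.fixingSubgroup
  have hcount : {V : Subgroup (absoluteGaloisGroup F) | IsOpen (V : Set (absoluteGaloisGroup F))}.Countable := by
    refine (hc.biUnion fun E (hE : FiniteDimensional F E) =>
      (finite_setOf_subgroup_le_of_isOpen (HS E) ?_).countable).mono ?_
    · haveI := hE
      exact IntermediateField.fixingSubgroup_isOpen E
    · intro V hV
      have hV' : IsOpen (V : Set (absoluteGaloisGroup F)) := hV
      have h1 : (V : Set (absoluteGaloisGroup F)) ∈ 𝓝 (1 : absoluteGaloisGroup F) :=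
        hV'.mem_nhds V.one_mem
      obtain ⟨E, hEfd, hEV⟩ := (krullTopology_mem_nhds_one_iff F (AlgebraicClosure F) _).1 h1
      exact Set.mem_biUnion (x := E) hEfd fun σ hσ => hEV hσ
  haveI := hcount.to_subtype
  exact Function.Injective.countable
    (f := fun V : OpenSubgroup (absoluteGaloisGroup F) =>
      (⟨(V : Subgroup (absoluteGaloisGroup F)), V.isOpen⟩ :
        {V : Subgroup (absoluteGaloisGroup F) | IsOpen (V : Set (absoluteGaloisGroup F))}))
    fun V W h => OpenSubgroup.toSubgroup_injective (congrArg Subtype.val h)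

/-- The set of open subgroups of `Γ_F` is countable (set form of
`countable_openSubgroup_of_isNonarchimedeanLocalField`). [cite: NeukirchANT1999, Ch. IV §1] -/
theorem countable_setOf_openSubgroup_of_isNonarchimedeanLocalField :
    Set.Countable (Set.range fun V : OpenSubgroup (absoluteGaloisGroup F) =>
      (V : Subgroup (absoluteGaloisGroup F))) := by
  haveI := countable_openSubgroup_of_isNonarchimedeanLocalField F
  exact Set.countable_range _

/-- **A cofinal decreasing sequence of open normal subgroups of `Γ_F`** inside a given OPEN
subgroup `W` (not necessarily normal — e.g. the kernel of a residual representation), for `F` a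
non-archimedean local field of characteristic `0`: `Deformation.exists_antitone_openNormal_seq` for
the compact group `Γ_F` with countably many open subgroups, applied to the (open) normal core of
`W`.  This is the indexing datum of the sequential construction of universal deformation rings of
representations of `Γ_F` (Mazur §20 Prop. 2, tree
`Deformation.LiftingCondition.exists_universal_of_finite`). [cite: Mazur1997Deformation, §20 Prop. 2] -/
theorem exists_antitone_openNormal_seq_le_of_isNonarchimedeanLocalField
    (W : Subgroup (absoluteGaloisGroup F)) (hW : IsOpen (W : Set (absoluteGaloisGroup F))) :
    ∃ U : ℕ → Subgroup (absoluteGaloisGroup F), (∀ N, (U N).Normal) ∧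
      (∀ N, IsOpen (U N : Set (absoluteGaloisGroup F))) ∧ Antitone U ∧ (∀ N, U N ≤ W) ∧
      ∀ V : Subgroup (absoluteGaloisGroup F), IsOpen (V : Set (absoluteGaloisGroup F)) → ∃ N, U N ≤ V := by
  have hcount : {V : Subgroup (absoluteGaloisGroup F) | IsOpen (V : Set (absoluteGaloisGroup F))}.Countable := by
    refine (countable_setOf_openSubgroup_of_isNonarchimedeanLocalField F).mono ?_
    intro V hV
    exact ⟨⟨V, hV⟩, rfl⟩
  obtain ⟨U, hUn, hUo, hUanti, hUle, hUcof⟩ :=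
    Deformation.exists_antitone_openNormal_seq hcount W.normalCore
      (Deformation.isOpen_normalCore_of_isOpen W hW)
  exact ⟨U, hUn, hUo, antitone_nat_of_succ_le hUanti, fun N => (hUle N).trans (Subgroup.normalCore_le W),
    hUcof⟩

end LocalField

end Literature.NumberTheory.GaloisRepresentations

end
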